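import Summits.Ventures.PercRepro.Night2ParallelLevelCore

/-!
# PercRepro — `ShadowC025Level` reduces to simple matroids (night-2, gen 11)

With the level-wise parallel reduction (`Night2ParallelLevelCore.lean`, `shadowLevel_card_of_parallel`):

* `choose_two_step`, **`choose_ratio_le`**: the level constants compare the right way —
  `C(p+q, u)/C(p+q, p) ≤ C(p+q−2, u−1)/C(p+q−2, p−1)` for `1 ≤ q < u < p`, because
  `u(n−u)·C(n, u) = n(n−1)·C(n−2, u−1)` and `p(n−p) = pq ≤ u(n−u)` (`(u−q)(p−u) ≥ 0`);
* `shadowHallLevel_of_Uq_empty`: the level-wise condition is void without bottom sets;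
* **`shadowHallLevel_of_eRank_of_simple`**: if the level-wise shadow form at every `(p, q, u)` holds on the
  SIMPLE matroids of rank `p`, it holds on every matroid of rank `p` (strong induction on `|E|`: delete a loop,
  or one element of a parallel pair, the contraction side at `(p − 1, q − 1, u − 1)`);
* **`shadowC025Level_of_simple`**: `ShadowC025Level` follows from its restriction to simple matroids of rank `p`.
-/

open scoped Matroid

namespace PercRepro.Shadow

open Finset PerFlat ThmH

variable {α : Type} [DecidableEq α]

section Binomial

/-- `(k + 1)(n + 1 − k) · C(n + 2, k + 1) = (n + 2)(n + 1) · C(n, k)`. -/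
theorem choose_two_step (n k : ℕ) :
    (k + 1) * (n + 1 - k) * (n + 1 + 1).choose (k + 1) = (n + 1 + 1) * (n + 1) * n.choose k := by
  have h1 : (n + 1).choose (k + 1) * (n + 1 + 1) = (n + 1 + 1).choose (k + 1) * (n + 1 + 1 - (k + 1)) :=
    Nat.choose_mul_succ_eq (n + 1) (k + 1)
  have h2 : (n + 1) * n.choose k = (n + 1).choose (k + 1) * (k + 1) := Nat.add_one_mul_choose_eq n k
  rw [show n + 1 + 1 - (k + 1) = n + 1 - k by omega] at h1
  calc (k + 1) * (n + 1 - k) * (n + 1 + 1).choose (k + 1)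
      = (k + 1) * ((n + 1 + 1).choose (k + 1) * (n + 1 - k)) := by ring
    _ = (k + 1) * ((n + 1).choose (k + 1) * (n + 1 + 1)) := by rw [← h1]
    _ = (n + 1 + 1) * ((n + 1).choose (k + 1) * (k + 1)) := by ring
    _ = (n + 1 + 1) * ((n + 1) * n.choose k) := by rw [← h2]
    _ = (n + 1 + 1) * (n + 1) * n.choose k := by ring

/-- **The level constants compare the right way**: for `1 ≤ q < u < p`,
`C(p+q, u)/C(p+q, p) ≤ C(p+q−2, u−1)/C(p+q−2, p−1)`. -/
theorem choose_ratio_le {p q u : ℕ} (hq : 1 ≤ q) (hqu : q < u) (hup : u < p) :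
    ((p + q).choose u : ℚ) / ((p + q).choose p : ℚ) ≤
      ((p - 1 + (q - 1)).choose (u - 1) : ℚ) / ((p - 1 + (q - 1)).choose (p - 1) : ℚ) := by
  obtain ⟨p', rfl⟩ : ∃ p', p = p' + 1 := ⟨p - 1, by omega⟩
  obtain ⟨q', rfl⟩ : ∃ q', q = q' + 1 := ⟨q - 1, by omega⟩
  obtain ⟨u', rfl⟩ : ∃ u', u = u' + 1 := ⟨u - 1, by omega⟩
  simp only [Nat.add_sub_cancel]
  rw [show p' + 1 + (q' + 1) = p' + q' + 1 + 1 by ring]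
  set n := p' + q' with hn
  have hu' : u' ≤ n := by omega
  have hp' : p' ≤ n := by omega
  have hapos : (0 : ℚ) < (n.choose u' : ℚ) := by exact_mod_cast Nat.choose_pos hu'
  have hbpos : (0 : ℚ) < (n.choose p' : ℚ) := by exact_mod_cast Nat.choose_pos hp'
  have hBpos : (0 : ℚ) < ((n + 1 + 1).choose (p' + 1) : ℚ) := by
    exact_mod_cast Nat.choose_pos (by omega : p' + 1 ≤ n + 1 + 1)
  -- the two identities, cast to ℚ
  have ha' : ((u' : ℚ) + 1) * ((n : ℚ) + 1 - u') * ((n + 1 + 1).choose (u' + 1) : ℚ)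
      = ((n : ℚ) + 1 + 1) * ((n : ℚ) + 1) * (n.choose u' : ℚ) := by
    have h := congrArg (Nat.cast : ℕ → ℚ) (choose_two_step n u')
    push_cast [Nat.cast_sub (show u' ≤ n + 1 by omega)] at h
    linarith [h]
  have hb' : ((p' : ℚ) + 1) * ((n : ℚ) + 1 - p') * ((n + 1 + 1).choose (p' + 1) : ℚ)
      = ((n : ℚ) + 1 + 1) * ((n : ℚ) + 1) * (n.choose p' : ℚ) := by
    have h := congrArg (Nat.cast : ℕ → ℚ) (choose_two_step n p')
    push_cast [Nat.cast_sub (show p' ≤ n + 1 by omega)] at h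
    linarith [h]
  -- the comparison of the two weights: (p'+1)(n+1-p') ≤ (u'+1)(n+1-u')
  have hYX : ((p' : ℚ) + 1) * ((n : ℚ) + 1 - p') ≤ ((u' : ℚ) + 1) * ((n : ℚ) + 1 - u') := by
    have h1 : (q' : ℚ) ≤ u' := by exact_mod_cast (by omega : q' ≤ u')
    have h2 : (u' : ℚ) ≤ p' := by exact_mod_cast (by omega : u' ≤ p')
    have hn' : (n : ℚ) = p' + q' := by rw [hn]; push_cast; ring
    rw [hn']
    nlinarith [mul_nonneg (sub_nonneg.2 h1) (sub_nonneg.2 h2)]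
  have hXpos : 0 < ((u' : ℚ) + 1) * ((n : ℚ) + 1 - u') := by
    have : (u' : ℚ) ≤ n := by exact_mod_cast hu'
    exact mul_pos (by positivity) (by linarith)
  have hYpos : 0 < ((p' : ℚ) + 1) * ((n : ℚ) + 1 - p') := by
    have : (p' : ℚ) ≤ n := by exact_mod_cast hp'
    exact mul_pos (by positivity) (by linarith)
  rw [div_le_div_iff₀ hBpos hbpos]
  set X := ((u' : ℚ) + 1) * ((n : ℚ) + 1 - u') with hX
  set Y := ((p' : ℚ) + 1) * ((n : ℚ) + 1 - p') with hY
  set A := ((n + 1 + 1).choose (u' + 1) : ℚ) with hA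
  set A' := (n.choose u' : ℚ) with hA'
  set P := ((n + 1 + 1).choose (p' + 1) : ℚ) with hP
  set P' := (n.choose p' : ℚ) with hP'
  have hnn : (0 : ℚ) ≤ ((n : ℚ) + 1 + 1) * ((n : ℚ) + 1) * A' * P' :=
    mul_nonneg (mul_nonneg (by positivity) hapos.le) hbpos.le
  have key : A * P' * (X * Y) ≤ A' * P * (X * Y) := by
    calc A * P' * (X * Y) = (X * A) * P' * Y := by ring
      _ = (((n : ℚ) + 1 + 1) * ((n : ℚ) + 1) * A') * P' * Y := by rw [ha']
      _ ≤ (((n : ℚ) + 1 + 1) * ((n : ℚ) + 1) * A') * P' * X := mul_le_mul_of_nonneg_left hYX hnn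
      _ = A' * (((n : ℚ) + 1 + 1) * ((n : ℚ) + 1) * P') * X := by ring
      _ = A' * (Y * P) * X := by rw [hb']
      _ = A' * P * (X * Y) := by ring
  exact le_of_mul_le_mul_right key (mul_pos hXpos hYpos)

end Binomial

section Reduction

/-- The level-wise shadow condition is void when there is no bottom set. -/
theorem shadowHallLevel_of_Uq_empty {M : Matroid α} [M.Finite] {p q u : ℕ} {c : ℚ} (h : Uq M p q = ∅) :
    ShadowHallLevel M p q u c := by
  intro 𝒜 h𝒜
  rw [h, Finset.subset_empty] at h𝒜
  subst h𝒜
  simp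

/-- **The level-wise shadow form reduces to simple matroids of rank `p`.**  If, for every `q < u < p`,
`ShadowHallLevel N p q u (C(p+q,u)/C(p+q,p))` holds on every matroid `N` of rank `p` without loops and parallel
pairs, then it holds on every matroid of rank `p`.  Strong induction on `|E|`, simultaneously in `(p, q, u)`: a
loop is deleted (`shadowHallLevel_of_delete_loop`), one element of a parallel pair is deleted
(`shadowLevel_card_of_parallel`, contraction side at `(p − 1, q − 1, u − 1)`, constants by `choose_ratio_le`). -/
theorem shadowHallLevel_of_eRank_of_simple
    (hsimple : ∀ (N : Matroid α) [N.Finite] (p q u : ℕ), q < u → u < p → N.eRank = (p : ℕ∞) →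
      (∀ e ∈ gr N, ∀ f ∈ gr N, e ≠ f → rkN N {e, f} = 2) →
      ShadowHallLevel N p q u (((p + q).choose u : ℚ) / ((p + q).choose p : ℚ)))
    {p q u : ℕ} (hqu : q < u) (hup : u < p) (M : Matroid α) [M.Finite] (hM : M.eRank = (p : ℕ∞)) :
    ShadowHallLevel M p q u (((p + q).choose u : ℚ) / ((p + q).choose p : ℚ)) := by
  classical
  suffices h : ∀ (n : ℕ) (p q u : ℕ), q < u → u < p → ∀ (N : Matroid α) [N.Finite], (gr N).card ≤ n →
      N.eRank = (p : ℕ∞) → ShadowHallLevel N p q u (((p + q).choose u : ℚ) / ((p + q).choose p : ℚ)) from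
    h (gr M).card p q u hqu hup M le_rfl hM
  intro n
  induction n using Nat.strong_induction_on with
  | _ n ihn =>
    intro p q u hqu hup N _ hn hN
    have hc : (0 : ℚ) ≤ ((p + q).choose u : ℚ) / ((p + q).choose p : ℚ) := by positivity
    by_cases hL : ∃ ℓ ∈ N.E, ¬ N.Indep {ℓ}
    · -- a loop: delete it
      obtain ⟨ℓ, hℓ, hl⟩ := hL
      have hℓg : ℓ ∈ gr N := by rw [← Finset.mem_coe, coe_gr]; exact hℓ
      have hcard : (gr (N ＼ ({ℓ} : Set α))).card < n := by
        rw [gr_delete, Finset.card_erase_of_mem hℓg]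
        have : 0 < (gr N).card := Finset.card_pos.2 ⟨ℓ, hℓg⟩
        omega
      have hloop : N.IsLoop ℓ := by
        by_contra h
        exact hl (Matroid.indep_singleton.2 ((Matroid.not_isLoop_iff hℓ).1 h))
      have hrk : (N ＼ ({ℓ} : Set α)).eRank = (p : ℕ∞) := by
        rw [eRank_delete_of_mem_closure (hloop.mem_closure _), hN]
      exact shadowHallLevel_of_delete_loop hℓ hl hc
        (ihn _ hcard p q u hqu hup (N ＼ ({ℓ} : Set α)) le_rfl hrk)
    · have hloopless : ∀ e ∈ gr N, N.Indep {e} := indep_singleton_of_no_loop hL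
      by_cases hP : ∀ e ∈ gr N, ∀ f ∈ gr N, e ≠ f → rkN N {e, f} = 2
      · exact hsimple N p q u hqu hup hN hP
      · -- a parallel pair `e`, `f`: delete `f`
        push Not at hP
        obtain ⟨e, he, f, hf, hef, hr⟩ := hP
        have hfE : f ∈ N.E := by rw [← coe_gr, Finset.mem_coe]; exact hf
        have heE : e ∈ N.E := by rw [← coe_gr, Finset.mem_coe]; exact he
        have hcl : f ∈ N.closure {e} := by
          by_contra h
          exact hr (rkN_pair_eq_two_of_notMem_closure (hloopless e he) hfE h)
        have hcard : (gr (N ＼ ({f} : Set α))).card < n := by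
          rw [gr_delete, Finset.card_erase_of_mem hf]
          have : 0 < (gr N).card := Finset.card_pos.2 ⟨f, hf⟩
          omega
        have hrk : (N ＼ ({f} : Set α)).eRank = (p : ℕ∞) := by
          rw [eRank_delete_of_mem_closure, hN]
          have hsub : ({e} : Set α) ⊆ N.E \ {f} :=
            Set.singleton_subset_iff.2 ⟨heE, fun h => hef (Set.mem_singleton_iff.1 h)⟩
          exact N.closure_subset_closure hsub hcl
        intro 𝒜 h𝒜
        by_cases hq : 1 ≤ q
        · -- contraction side at `(p − 1, q − 1, u − 1)`
          have hcard' : (gr (N ／ ({f} : Set α))).card < n := by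
            rw [gr_contract, Finset.card_erase_of_mem hf]
            have : 0 < (gr N).card := Finset.card_pos.2 ⟨f, hf⟩
            omega
          have hrk' : (N ／ ({f} : Set α)).eRank = ((p - 1 : ℕ) : ℕ∞) :=
            eRank_contract_singleton (hloopless f hf) hN
          exact shadowLevel_card_of_parallel (hloopless f hf) heE hcl hef hN (by omega) hc
            (choose_ratio_le hq hqu hup) h𝒜
            (fun _ => ihn _ hcard' (p - 1) (q - 1) (u - 1) (by omega) (by omega) (N ／ ({f} : Set α))
              le_rfl hrk')
            (ihn _ hcard p q u hqu hup (N ＼ ({f} : Set α)) le_rfl hrk)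
        · -- `q = 0`: the contraction side is void; any `c' ≥ c` will do
          exact shadowLevel_card_of_parallel (hloopless f hf) heE hcl hef hN (by omega) hc le_rfl h𝒜
            (fun hq' => absurd hq' hq)
            (ihn _ hcard p q u hqu hup (N ＼ ({f} : Set α)) le_rfl hrk)

/-- **`ShadowC025Level` reduces to simple matroids**: if, for every `q < u < p`, the level-wise shadow form
holds on every finite matroid of rank `p` without loops and parallel pairs, then it holds on every finite
matroid at every `(p, q, u)`. -/
theorem shadowC025Level_of_simple
    (hsimple : ∀ {α : Type} [DecidableEq α] (N : Matroid α) [N.Finite] (p q u : ℕ), q < u → u < p →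
      N.eRank = (p : ℕ∞) → (∀ e ∈ gr N, ∀ f ∈ gr N, e ≠ f → rkN N {e, f} = 2) →
      ShadowHallLevel N p q u (((p + q).choose u : ℚ) / ((p + q).choose p : ℚ))) : ShadowC025Level := by
  intro α _ M _ p q u hqu hup
  by_cases hlt : M.eRank < (p : ℕ∞)
  · exact shadowHallLevel_of_Uq_empty (Uq_eq_empty_of_eRank_lt hlt)
  · have hge : (p : ℕ∞) ≤ M.eRank := not_lt.1 hlt
    apply shadowHallLevel_of_truncate M (by omega : q < p) hup
    apply shadowHallLevel_of_eRank_of_simple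
      (fun N _ p q u hqu hup hN hs => hsimple N p q u hqu hup hN hs) hqu hup
    rw [Matroid.eRank_def, PercRepro.Matroid.truncate_ground, PercRepro.Matroid.truncate_eRk_eq_of_ge]
    rw [Matroid.eRk_ground]
    exact hge

end Reduction

end PercRepro.Shadow
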